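import Summits.AtomisticToContinuum.BoseEinsteinCondensation.Theorems.BECThomsonPrincipleGDTransferSeededPlainPairAlgebra
import Summits.AtomisticToContinuum.BoseEinsteinCondensation.Theorems.BECThomsonPrincipleGDTransferSeededPlainInteraction
import Summits.AtomisticToContinuum.BoseEinsteinCondensation.Theorems.BECThomsonPrincipleGDTransferSeededPlainPairCost
import Summits.AtomisticToContinuum.BoseEinsteinCondensation.Theorems.BECThomsonPrincipleGDTransferSeededWeightedWindowLaw
import Summits.AtomisticToContinuum.BoseEinsteinCondensation.Theorems.BECThomsonPrincipleGDTransferSeededBandFromWindow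
import Summits.AtomisticToContinuum.BoseEinsteinCondensation.Theorems.BECThomsonPrincipleGDTransferSeededReduction

/-!
# Route `BECThomsonPrinciple`, crux `GDTransfer` (stmt-AtomisticToContinuum-9482), line `seeded-continuity`:
# the dichotomy closed — Gaussian domination empties the middle band (finite continuous profiles)

Supports (does not close) stmt-AtomisticToContinuum-9482.  Composes the five landed v3 stubs over the plain witness pair
(`stub_plainPairAlgebra`, `stub_plainInteraction`, `stub_plainPairCost`, `stub_weightedWindowLaw`, `stub_bandFromWindow`)
through the landed glue `projectedDichotomy_of` (`…SeededWitnessDefs`) into the registered v2 stub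
`stub_projectedDichotomy : GaussianDominationCan → ∀ v admissible finite-continuous, BandEmptiness v`
(`stub_projectedDichotomy_closed`), spells it out (`gd_bandEmptiness`), and records the resulting reduction of the crux to
the SEED and the ROUGH-POTENTIAL regime (`GDTransfer_of_seed_of_rough`, via the landed `GDTransfer_of_open_stubs` of
`…SeededReduction`) together with the soft conclusion from the seed alone
(`soft_periodicBEC_of_seed` : seed ∧ GD ⇒ `PeriodicBECFor v` for every admissible finite continuous `v`, via the landed
`periodicBECFor_of_seed_of_bandEmptiness`).

References: KennedyLiebShastry1988 (IR bound ⇒ order); LSSY2005 §1.2, Thm 2.2, Ch. 5, App. A; arXiv:1211.2778 §2.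
-/

noncomputable section

namespace Summit.AtomisticToContinuum.BoseEinsteinCondensation.Cruxes.GDTransfer.Seeded

open Literature.MathematicalPhysics.QuantumManyBody.BoseGas
open Summit.AtomisticToContinuum.BoseEinsteinCondensation.Theses.BECThomsonPrinciple
open Summit.AtomisticToContinuum.BoseEinsteinCondensation.Cruxes.GDTransfer.DysonDressedWitness (PeriodicBECFor)
open scoped ENNReal

/-- **Registered stub `stub_projectedDichotomy` (v2), now a theorem**: Gaussian domination empties the middle band of the
`n̂₀`-law of near-minimisers, uniformly down the density scale, for every admissible finite continuous pair potential —
the five v3 pieces over the plain pair composed by `projectedDichotomy_of`. -/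
theorem stub_projectedDichotomy_closed : Sig.stub_projectedDichotomy :=
  projectedDichotomy_of stub_plainPairAlgebra stub_plainInteraction stub_plainPairCost stub_weightedWindowLaw
    stub_bandFromWindow

/-- **GD ⇒ band emptiness** (the statement of `stub_projectedDichotomy`, spelled out): under Gaussian domination the middle
band `θN ≤ n̂₀ < (1−β)N` of the `n̂₀`-law of near-minimisers is empty, uniformly down the density scale, for every
admissible finite continuous `v`. -/
theorem gd_bandEmptiness : Summit.AtomisticToContinuum.BoseEinsteinCondensation.Theses.BECThomsonPrinciple.GaussianDominationCan → ∀ v : ℝ → ENNReal, Literature.MathematicalPhysics.QuantumManyBody.BoseGas.IsRepulsiveFiniteRange v → Summit.AtomisticToContinuum.BoseEinsteinCondensation.Cruxes.GDTransfer.Seeded.IsFiniteContinuous v → Summit.AtomisticToContinuum.BoseEinsteinCondensation.Cruxes.GDTransfer.Seeded.BandEmptiness v :=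
  stub_projectedDichotomy_closed

/-- **The crux from the seed and the rough-potential regime**: with the dichotomy closed, `GDTransfer` follows from the two
remaining registered stubs `stub_noBalancedCat` (the seed) and `stub_roughPotentials` alone. -/
theorem GDTransfer_of_seed_of_rough : Summit.AtomisticToContinuum.BoseEinsteinCondensation.Cruxes.GDTransfer.Seeded.Sig.stub_noBalancedCat → Summit.AtomisticToContinuum.BoseEinsteinCondensation.Cruxes.GDTransfer.Seeded.Sig.stub_roughPotentials → Summit.AtomisticToContinuum.BoseEinsteinCondensation.Theses.BECThomsonPrinciple.GDTransfer :=
  fun hS hR => GDTransfer_of_open_stubs hS stub_projectedDichotomy_closed hR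

/-- **Soft transfer from the seed** (the strategist's child `SoftSeededTransfer`): if near-minimisers are never balanced
cats, then Gaussian domination gives condensation of the near-minimisers of the periodic energy at every small density,
for every admissible finite continuous pair potential. -/
theorem soft_periodicBEC_of_seed : Summit.AtomisticToContinuum.BoseEinsteinCondensation.Cruxes.GDTransfer.Seeded.Sig.stub_noBalancedCat → Summit.AtomisticToContinuum.BoseEinsteinCondensation.Theses.BECThomsonPrinciple.GaussianDominationCan → ∀ v : ℝ → ENNReal, Literature.MathematicalPhysics.QuantumManyBody.BoseGas.IsRepulsiveFiniteRange v → Summit.AtomisticToContinuum.BoseEinsteinCondensation.Cruxes.GDTransfer.Seeded.IsFiniteContinuous v → Summit.AtomisticToContinuum.BoseEinsteinCondensation.Cruxes.GDTransfer.DysonDressedWitness.PeriodicBECFor v :=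
  fun hSeed hG v hv hfc =>
    periodicBECFor_of_seed_of_bandEmptiness hSeed hv hfc (gd_bandEmptiness hG v hv hfc)

end Summit.AtomisticToContinuum.BoseEinsteinCondensation.Cruxes.GDTransfer.Seeded

end
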